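import Mathlib
import Summits.Ventures.PercRepro2.BluePin

/-!
# The spare element: (BP) on `Option E` gives (AS3) for every nested pair on `E`
(seat mine-b, cell pub-perc-repro2; conjectures/MINE-B.md §14)

`bluePinStep_iff_AS3_nested` (BluePin.lean) needs a spare element `q ∉ U` to turn (AS3) on the cube `U`
into a blue-pin instance.  Lifting the events to `Option E` (`liftEv`: the up-closure of the image under
`some`) supplies `none` as the spare element: disjoint occurrences and the (AS3) counts transfer along
the injection `γ ↦ γ.map some` (`dOcc_liftEv_iff`, `AS3_liftEv_iff`), so

* `AS3_of_bluePinStep_option` — **if every clutter on `Option E` satisfies (BP), then (AS3) holds for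
  every nested pair `B ⊆ A` (first event bigger) on every cube `U ⊆ E`** — no spare element needed on
  `E` itself.  (The pairs `(pinFlow j, pinCarries)` of `stepH_zero_of_AS3` have the first event smaller
  and are not covered.)
-/

open Finset

namespace Summit.Ventures.PercRepro2

namespace StepZero

open ReimerCube

variable {E : Type*} [DecidableEq E]

open Classical

/-- the embedding `some : E ↪ Option E` -/
abbrev emb : E ↪ Option E := Function.Embedding.some

/-- the lift of an event to `Option E`: the up-closure of the image of the event under `some` -/
def liftEv (A : Finset E → Prop) (X : Finset (Option E)) : Prop :=
  ∃ S : Finset E, S.map emb ⊆ X ∧ A S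

omit [DecidableEq E] in
/-- the lift is increasing (for any event) -/
lemma incr_liftEv (A : Finset E → Prop) : Incr (liftEv A) := by
  rintro S T hST ⟨K, hK, hA⟩
  exact ⟨K, hK.trans hST, hA⟩

omit [DecidableEq E] in
/-- on images the lift is the event itself -/
lemma liftEv_map {A : Finset E → Prop} (hA : Incr A) (S : Finset E) :
    liftEv A (S.map emb) ↔ A S := by
  constructor
  · rintro ⟨K, hK, hAK⟩
    exact hA (Finset.map_subset_map.mp hK) hAK
  · exact fun h => ⟨S, le_rfl, h⟩

omit [DecidableEq E] in
/-- up-witnesses transfer along the lift -/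
lemma liftEv_witness_iff {A : Finset E → Prop} (hA : Incr A) (K : Finset E) :
    (∀ T, K.map emb ⊆ T → liftEv A T) ↔ (∀ T, K ⊆ T → A T) := by
  constructor
  · intro h T hKT
    exact (liftEv_map hA T).mp (h (T.map emb) (Finset.map_subset_map.mpr hKT))
  · intro h T hKT
    exact ⟨K, hKT, h K le_rfl⟩

omit [DecidableEq E] in
/-- disjoint occurrences transfer along the lift -/
lemma dOcc_liftEv_iff {A B : Finset E → Prop} (hA : Incr A) (hB : Incr B) (S : Finset E) :
    DOcc (liftEv A) (liftEv B) (S.map emb) ↔ DOcc A B S := by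
  constructor
  · rintro ⟨K', L', hK', hL', hKL', hAK, hBL⟩
    obtain ⟨K, hK, rfl⟩ := Finset.subset_map_iff.mp hK'
    obtain ⟨L, hL, rfl⟩ := Finset.subset_map_iff.mp hL'
    exact ⟨K, L, hK, hL, (Finset.disjoint_map emb).mp hKL', (liftEv_witness_iff hA K).mp hAK,
      (liftEv_witness_iff hB L).mp hBL⟩
  · rintro ⟨K, L, hK, hL, hKL, hAK, hBL⟩
    exact ⟨K.map emb, L.map emb, Finset.map_subset_map.mpr hK, Finset.map_subset_map.mpr hL,
      (Finset.disjoint_map emb).mpr hKL, (liftEv_witness_iff hA K).mpr hAK,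
      (liftEv_witness_iff hB L).mpr hBL⟩

omit [DecidableEq E] in
/-- the configurations of the lifted cube are the images of the configurations of the cube: the
filtered counts agree (stated for arbitrary decidability instances) -/
lemma card_filter_powerset_map (U : Finset E) (P : Finset E → Prop) (P' : Finset (Option E) → Prop)
    [DecidablePred P] [DecidablePred P'] (hP : ∀ γ, γ ⊆ U → (P' (γ.map emb) ↔ P γ)) :
    ((U.map emb).powerset.filter P').card = (U.powerset.filter P).card := by
  have e : (U.map emb).powerset.filter P'
      = (U.powerset.filter P).map ⟨fun γ => γ.map emb, Finset.map_injective emb⟩ := by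
    ext γ'
    rw [Finset.mem_filter, Finset.mem_powerset, Finset.mem_map]
    constructor
    · rintro ⟨hsub, hP'⟩
      obtain ⟨γ, hγU, rfl⟩ := Finset.subset_map_iff.mp hsub
      refine ⟨γ, ?_, rfl⟩
      rw [Finset.mem_filter, Finset.mem_powerset]
      exact ⟨hγU, (hP γ hγU).mp hP'⟩
    · rintro ⟨γ, hγ, rfl⟩
      rw [Finset.mem_filter, Finset.mem_powerset] at hγ
      exact ⟨Finset.map_subset_map.mpr hγ.1, (hP γ hγ.1).mpr hγ.2⟩
  rw [e, Finset.card_map]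

/-- **(AS3) transfers along the lift**: `AS3 (U.map some) (liftEv A) (liftEv B) ↔ AS3 U A B`. -/
theorem AS3_liftEv_iff {A B : Finset E → Prop} (hA : Incr A) (hB : Incr B) (U : Finset E) :
    AS3 (U.map emb) (liftEv A) (liftEv B) ↔ AS3 U A B := by
  unfold AS3
  rw [card_filter_powerset_map U (fun γ => DOcc A B γ ∧ ¬ B (U \ γ))
    (fun γ' => DOcc (liftEv A) (liftEv B) γ' ∧ ¬ liftEv B (U.map emb \ γ')) (by
      intro γ _
      rw [← Finset.map_sdiff, dOcc_liftEv_iff hA hB, liftEv_map hB])]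
  rw [card_filter_powerset_map U (fun γ => A γ ∧ B (U \ γ) ∧ ¬ DOcc B B (U \ γ))
    (fun γ' => liftEv A γ' ∧ liftEv B (U.map emb \ γ') ∧ ¬ DOcc (liftEv B) (liftEv B) (U.map emb \ γ'))
    (by
      intro γ _
      rw [← Finset.map_sdiff, liftEv_map hA, liftEv_map hB, dOcc_liftEv_iff hB hB])]

/-- **(BP) for every clutter on `Option E` gives (AS3) for every nested pair on every cube of `E`.** -/
theorem AS3_of_bluePinStep_option
    (h : ∀ A' : Finset (Option E) → Prop, Incr A' → BluePinStep A')
    {A B : Finset E → Prop} (hA : Incr A) (hB : Incr B) (hBA : ∀ X, B X → A X) (U : Finset E) :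
    AS3 U A B := by
  rw [← AS3_liftEv_iff hA hB U]
  have hnone : (none : Option E) ∉ U.map emb := by
    intro hmem
    obtain ⟨a, -, ha⟩ := Finset.mem_map.mp hmem
    exact Option.some_ne_none a ha
  exact (bluePinStep_iff_AS3_nested.mp h) (liftEv A) (liftEv B) (incr_liftEv A) (incr_liftEv B)
    (fun X ⟨K, hK, hBK⟩ => ⟨K, hK, hBA K hBK⟩) (U.map emb) none hnone

end StepZero

end Summit.Ventures.PercRepro2
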